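import Literature.Analysis.Matrix.LogDetMixedDifferenceLocallySummed
import Mathlib.Tactic.NoncommRing
import HarnessLib

/-!
# The mixed second difference of the one-loop TRACE `tr(K⁻¹H)` over a rectangle of matrices, with LOCALLY SUMMED variations
# (the sibling of `LogDetMixedDifferenceLocallySummed` for `tr(K⁻¹H)` instead of `log det K`; purely algebraic, card-free)

Topic `Literature/Analysis/Matrix`; namespace `Literature.Analysis.Matrix`.  Sequel of `LogDetMixedDifference.lean` (`trace_inv_mul_sub`,
`abs_trace_mul_le_sum`) and `LogDetMixedDifferenceLocallySummed.lean` (`abs_trace_mul_le_of_entry_le_of_sum_le`,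
`sum_sum_abs_le_of_twoProfile_range`).  Everything here is PROVED; no definitions, no named facts; real matrices over a finite
index type with an `ℕ`-valued pseudo-distance `dist` (only symmetry and the displayed separation rows are used).

THE QUESTION.  Four invertible matrices at the corners of a rectangle — `K₀₀, K₁₀` (one «bond» `b` varied, move size `s`),
`K₀₁, K₁₁` (a second bond `b′` varied as well, size `t`) — four matrices `H i j` at the same corners, and the mixed second difference
of the ONE-LOOP TRACE `ΔΔ tr(K⁻¹H) := tr(K₁₁⁻¹H₁₁) − tr(K₁₀⁻¹H₁₀) − tr(K₀₁⁻¹H₀₁) + tr(K₀₀⁻¹H₀₀)`.  When the `b`-differences of `K`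
and `H` are localised (in the summed sense) along a profile `d`, the `b′`-differences along a profile `d′`, the double differences are
ℓ¹-small, and the inverses carry Combes–Thomas decay `|K⁻¹ a b| ≤ α·e^{−θ·dist a b}` (`CoerciveCombesThomas.coercive_combes_thomas`,
`LogDetMixedDifferenceExpLocalised.coercive_combes_thomas_real`), then `ΔΔ tr(K⁻¹H)` is `O(s·t·e^{−(θ−θ₂)·R})` with `R` the
separation of the two profiles and constants that are LOCAL SUMS — no `Fintype.card`.  Unlike `log det`, differences of `K⁻¹` are
ALGEBRAIC (first resolvent identity), so no path, no differentiability and no FTC enter: the four corners are the only data.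

* §1 ALGEBRA — `doubleDiff_mul_eq_matrix` (discrete Leibniz `ΔΔ(A·H) = A₁₁·ΔΔH + (A₁₁ − A₀₁)(H₀₁ − H₀₀) + (A₁₁ − A₁₀)(H₁₀ − H₀₀) + ΔΔA·H₀₀`),
  `inv_sub_inv_eq_neg_mul` (first resolvent identity, signed), ★`doubleDiff_inv_eq` (the second-order resolvent expansion
  `ΔΔ(K⁻¹) = −K₁₁⁻¹·ΔΔK·K₀₁⁻¹ + K₁₁⁻¹·Δ¹K₀·K₀₁⁻¹·Δ²K₀·K₀₀⁻¹ + K₁₁⁻¹·Δ²K₁·K₁₀⁻¹·Δ¹K₀·K₀₀⁻¹`).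
* §2 SUMMED BOUNDS — `abs_mul3_apply_le_of_sum_le` (entries of `X·H·Y` with an ℓ¹ middle factor: `≤ ξ·η·υ`), `sum_sum_abs_mul3_le`,
  ★`sum_sum_abs_mul3_le_of_summedProfiles` (ℓ¹ norm of `E·M·D` with COLUMN sums of `E` along `p`, Combes–Thomas middle factor `M`,
  ROW sums of `D` along `q`, separation `R ≤ p b + dist b c + q c`, local sums `S_p, S_dist`: `≤ ε·μ·δ·S_p·S_dist·e^{−(θ−θ₂)R}` — the
  decay BETWEEN two localised factors is carried by the inverse sandwiched between them).
* §3 ★★`abs_fourPt_trace_inv_mul_le_of_summedProfiles` — THE RECTANGLE: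
  `|ΔΔ tr(K⁻¹H)| ≤ (α·h₁₂ + α²·S_loc·S_dist·(k₁h₂ + k₂h₁) + α²·η·k₁₂ + 2·α³·η·S_loc·S_dist·k₁k₂)·s·t·e^{−(θ−θ₂)·R}` under: Combes–Thomas
  profile `α, θ` of the four inverses; column∕row-summed one-profile rows `k₁·s·e^{−θ d}`, `k₂·t·e^{−θ d′}` for the first differences of
  `K` and `h₁·s·e^{−θ d}`, `h₂·t·e^{−θ d′}` for those of `H`; ℓ¹ rows `Σ|H₀₀| ≤ η`, `Σ|ΔΔK| ≤ k₁₂·s·t·e^{−(θ−θ₂)R}`, `Σ|ΔΔH| ≤ h₁₂·s·t·e^{−(θ−θ₂)R}`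
  (the last two from pointwise TWO-PROFILE rows by `sum_sum_abs_le_of_twoProfile_range`); local sums `S_loc` (profiles), `S_dist`
  (kernel rows).  It is the localised, card-free edition of the normed-ring bilinear bound
  `‖ΔΔ(K⁻¹H)‖ ≤ (a·h₁₂ + a²(k₁h₂ + k₂h₁) + (a²k₁₂ + 2a³k₁k₂)·h)·s·t` (same polynomial, `S`-decorated, `h ↦ η`).

WHY (consumer: cell `ym3-torus`, crux `FluctuationComparisonRegPrIntL`, LINE `Lines/runpair_organ.lean`, the (I-curv) letters of the row
`OrganDischargeInputsHJsq` v0.4 after A5; DISCHARGE-SPEC v1.8 §11 (xv)): the one-loop object of a covariant organ is the trace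
`tr(K_V^{−1}H^O_V)` — `K_V` the (horizontal) Hessian of the action at the background determined by the coarse field `V`, `H^O_V` the Hessian of
a gauge-invariant local functional — and its (I-curv) letter is the second variation of that trace under two coarse one-bond moves, to be
bounded by `C·s·t·e^{−κ·tdist(b,b′)}`.  The mechanism in print ([Balaban1985Variational] Thm 1 (10) p. 279 with [Balaban1984PropagatorsII] (1.33);
[GlimmJaffe1987, §18.2] for the generic one-loop clustering): the background responds to each move with exponential tails, so `ΔK`, `ΔH`
are exponentially localised near the moved bond (`LocalisedResponse`, `LocalisedVariation`), and the propagator `K⁻¹` decays exponentially.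
This file is the finite-dimensional bookkeeping that turns those rows into the bound; it is the `tr(K⁻¹H)`-twin of the `log det` rectangle
used by the same cell's semiclassical line.

HONEST SCOPE: finite-dimensional linear algebra (six products, two summation lemmas); every row is a HYPOTHESIS of the theorem; in which
indexing (fine bonds, coarse blocks, …) the constants `α, θ, S_loc, S_dist` and the letters are uniform in the size of the system is the
consumer's analysis ([Balaban1984PropagatorsII]) and is NOT addressed here.  Nothing here bears on the Yang–Mills mass gap (Clay), which is
NOT proved.

References: T. Bałaban, CMP 102 (1985) 277, Thm 1 (10) p. 279 [Balaban1985Variational]; CMP 96 (1984) 223, (1.33) [Balaban1984PropagatorsII];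
J. Glimm, A. Jaffe, *Quantum Physics* (2nd ed. 1987) §18.2 [GlimmJaffe1987]; M. Aizenman, S. Warzel, *Random Operators* (2015) §10.3
[AizenmanWarzel2015]; R. A. Horn, C. R. Johnson, *Matrix Analysis* (2013) §0.7.4 (inverse of a perturbed matrix), §5.6 (entrywise estimates)
[HornJohnson2013].
-/

noncomputable section

open Matrix Finset
open scoped Matrix

namespace Literature.Analysis.Matrix

variable {n : Type*} [Fintype n] [DecidableEq n]

/-! ## §1 Algebra: discrete Leibniz and the resolvent expansions for matrices -/

omit [DecidableEq n] in
/-- **Discrete Leibniz** for the mixed second difference of a product of matrices over a two-parameter square (corners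
`X₀₀ X₀₁ X₁₀ X₁₁`): `ΔΔ(A·H) = A₁₁·ΔΔH + (A₁₁ − A₀₁)·(H₀₁ − H₀₀) + (A₁₁ − A₁₀)·(H₁₀ − H₀₀) + ΔΔA·H₀₀`.
[cite: HornJohnson2013, §0.7.4] -/
theorem doubleDiff_mul_eq_matrix (A₀₀ A₀₁ A₁₀ A₁₁ H₀₀ H₀₁ H₁₀ H₁₁ : Matrix n n ℝ) :
    A₁₁ * H₁₁ - A₁₀ * H₁₀ - A₀₁ * H₀₁ + A₀₀ * H₀₀ =
      A₁₁ * (H₁₁ - H₁₀ - H₀₁ + H₀₀) + (A₁₁ - A₀₁) * (H₀₁ - H₀₀) + (A₁₁ - A₁₀) * (H₁₀ - H₀₀) +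
        (A₁₁ - A₁₀ - A₀₁ + A₀₀) * H₀₀ := by
  noncomm_ring

/-- **First resolvent identity** (signed): `K₁⁻¹ − K₀⁻¹ = −(K₁⁻¹·(K₁ − K₀)·K₀⁻¹)` for invertible `K₀, K₁`.
[cite: HornJohnson2013, §0.7.4] -/
theorem inv_sub_inv_eq_neg_mul {K₀ K₁ : Matrix n n ℝ} (h₀ : K₀.det ≠ 0) (h₁ : K₁.det ≠ 0) :
    K₁⁻¹ - K₀⁻¹ = -(K₁⁻¹ * (K₁ - K₀) * K₀⁻¹) := by
  have hu₀ : IsUnit K₀.det := isUnit_iff_ne_zero.2 h₀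
  have hu₁ : IsUnit K₁.det := isUnit_iff_ne_zero.2 h₁
  rw [Matrix.mul_sub, Matrix.sub_mul, Matrix.nonsing_inv_mul _ hu₁, Matrix.one_mul, Matrix.mul_assoc,
    Matrix.mul_nonsing_inv _ hu₀, Matrix.mul_one]
  abel

/-- **Second-order resolvent expansion of the double difference of inverses.**  For four invertible corners `K i j` with
`Δ¹K₀ := K₁₀ − K₀₀`, `Δ²K₀ := K₀₁ − K₀₀`, `Δ²K₁ := K₁₁ − K₁₀`, `ΔΔK := K₁₁ − K₁₀ − K₀₁ + K₀₀`:
`ΔΔ(K⁻¹) = −K₁₁⁻¹·ΔΔK·K₀₁⁻¹ + K₁₁⁻¹·Δ¹K₀·K₀₁⁻¹·Δ²K₀·K₀₀⁻¹ + K₁₁⁻¹·Δ²K₁·K₁₀⁻¹·Δ¹K₀·K₀₀⁻¹`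
(the first resolvent identity applied three times). [cite: HornJohnson2013, §0.7.4] -/
theorem doubleDiff_inv_eq {K₀₀ K₀₁ K₁₀ K₁₁ : Matrix n n ℝ} (h₀₀ : K₀₀.det ≠ 0) (h₀₁ : K₀₁.det ≠ 0)
    (h₁₀ : K₁₀.det ≠ 0) (h₁₁ : K₁₁.det ≠ 0) :
    K₁₁⁻¹ - K₁₀⁻¹ - K₀₁⁻¹ + K₀₀⁻¹ =
      -(K₁₁⁻¹ * (K₁₁ - K₁₀ - K₀₁ + K₀₀) * K₀₁⁻¹) +
        K₁₁⁻¹ * (K₁₀ - K₀₀) * K₀₁⁻¹ * (K₀₁ - K₀₀) * K₀₀⁻¹ +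
        K₁₁⁻¹ * (K₁₁ - K₁₀) * K₁₀⁻¹ * (K₁₀ - K₀₀) * K₀₀⁻¹ := by
  have e1 : K₁₁⁻¹ - K₀₁⁻¹ = -(K₁₁⁻¹ * (K₁₁ - K₀₁) * K₀₁⁻¹) := inv_sub_inv_eq_neg_mul h₀₁ h₁₁
  have e2 : K₁₀⁻¹ - K₀₀⁻¹ = -(K₁₀⁻¹ * (K₁₀ - K₀₀) * K₀₀⁻¹) := inv_sub_inv_eq_neg_mul h₀₀ h₁₀
  have e3 : K₀₁⁻¹ - K₀₀⁻¹ = -(K₀₁⁻¹ * (K₀₁ - K₀₀) * K₀₀⁻¹) := inv_sub_inv_eq_neg_mul h₀₀ h₀₁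
  have e4 : K₁₁⁻¹ - K₁₀⁻¹ = -(K₁₁⁻¹ * (K₁₁ - K₁₀) * K₁₀⁻¹) := inv_sub_inv_eq_neg_mul h₁₀ h₁₁
  have key : K₁₁⁻¹ - K₁₀⁻¹ - K₀₁⁻¹ + K₀₀⁻¹ =
      -(K₁₁⁻¹ * (K₁₁ - K₁₀ - K₀₁ + K₀₀) * K₀₁⁻¹) - K₁₁⁻¹ * (K₁₀ - K₀₀) * (K₀₁⁻¹ - K₀₀⁻¹)
        - (K₁₁⁻¹ - K₁₀⁻¹) * (K₁₀ - K₀₀) * K₀₀⁻¹ := by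
    have : K₁₁⁻¹ - K₁₀⁻¹ - K₀₁⁻¹ + K₀₀⁻¹ = (K₁₁⁻¹ - K₀₁⁻¹) - (K₁₀⁻¹ - K₀₀⁻¹) := by abel
    rw [this, e1, e2]
    noncomm_ring
  rw [key, e3, e4]
  noncomm_ring


/-! ## §2 Entry and ℓ¹ bounds for products with localised middle factors -/

omit [DecidableEq n] in
/-- Entries of a triple product `X·H·Y` with the MIDDLE factor summable: if `|X| ≤ ξ`, `|Y| ≤ υ` (`ξ, υ ≥ 0`) and
`Σ_f Σ_i |H f i| ≤ η`, then `|(X·H·Y) b a| ≤ ξ·η·υ` (no `Fintype.card`). [cite: HornJohnson2013, §5.6] -/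
theorem abs_mul3_apply_le_of_sum_le {X H Y : Matrix n n ℝ} {ξ η υ : ℝ} (hξ : 0 ≤ ξ) (hυ : 0 ≤ υ)
    (hX : ∀ a b, |X a b| ≤ ξ) (hY : ∀ a b, |Y a b| ≤ υ) (hH : ∑ f, ∑ i, |H f i| ≤ η) (b a : n) :
    |(X * H * Y) b a| ≤ ξ * η * υ := by
  rw [Matrix.mul_apply]
  refine (Finset.abs_sum_le_sum_abs _ _).trans ?_
  have h1 : ∀ i, |(X * H) b i * Y i a| ≤ ∑ f, ξ * |H f i| * υ := by
    intro i
    rw [abs_mul, Matrix.mul_apply]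
    calc |∑ f, X b f * H f i| * |Y i a| ≤ (∑ f, |X b f * H f i|) * υ :=
          mul_le_mul (Finset.abs_sum_le_sum_abs _ _) (hY i a) (abs_nonneg _)
            (Finset.sum_nonneg fun f _ => abs_nonneg _)
      _ = ∑ f, |X b f| * |H f i| * υ := by rw [Finset.sum_mul]; simp only [abs_mul]
      _ ≤ ∑ f, ξ * |H f i| * υ := Finset.sum_le_sum fun f _ =>
          mul_le_mul_of_nonneg_right (mul_le_mul_of_nonneg_right (hX b f) (abs_nonneg _)) hυ
  calc ∑ i, |(X * H) b i * Y i a| ≤ ∑ i, ∑ f, ξ * |H f i| * υ := Finset.sum_le_sum fun i _ => h1 i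
    _ = ξ * (∑ f, ∑ i, |H f i|) * υ := by
        rw [Finset.sum_comm, Finset.mul_sum, Finset.sum_mul]
        refine Finset.sum_congr rfl fun f _ => ?_
        rw [Finset.mul_sum, Finset.sum_mul]
    _ ≤ ξ * η * υ := mul_le_mul_of_nonneg_right (mul_le_mul_of_nonneg_left hH hξ) hυ

omit [DecidableEq n] in
/-- The ℓ¹ norm of a triple product is bounded by COLUMN sums of the first factor, entries of the middle one and ROW sums of the
last: `Σ_a Σ_e |(E·M·D) a e| ≤ Σ_b Σ_c (Σ_a |E a b|)·|M b c|·(Σ_e |D c e|)`. [cite: HornJohnson2013, §5.6] -/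
theorem sum_sum_abs_mul3_le (E M D : Matrix n n ℝ) :
    ∑ a, ∑ e, |(E * M * D) a e| ≤ ∑ b, ∑ c, (∑ a, |E a b|) * |M b c| * (∑ e, |D c e|) := by
  have hpt : ∀ a e, |(E * M * D) a e| ≤ ∑ b, ∑ c, |E a b| * |M b c| * |D c e| := by
    intro a e
    rw [Matrix.mul_apply]
    refine (Finset.abs_sum_le_sum_abs _ _).trans ?_
    have h1 : ∀ c, |(E * M) a c * D c e| ≤ ∑ b, |E a b| * |M b c| * |D c e| := by
      intro c
      rw [abs_mul, Matrix.mul_apply]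
      calc |∑ b, E a b * M b c| * |D c e| ≤ (∑ b, |E a b * M b c|) * |D c e| :=
            mul_le_mul_of_nonneg_right (Finset.abs_sum_le_sum_abs _ _) (abs_nonneg _)
        _ = ∑ b, |E a b| * |M b c| * |D c e| := by rw [Finset.sum_mul]; simp only [abs_mul]
    calc ∑ c, |(E * M) a c * D c e| ≤ ∑ c, ∑ b, |E a b| * |M b c| * |D c e| := Finset.sum_le_sum fun c _ => h1 c
      _ = ∑ b, ∑ c, |E a b| * |M b c| * |D c e| := Finset.sum_comm
  calc ∑ a, ∑ e, |(E * M * D) a e| ≤ ∑ a, ∑ e, ∑ b, ∑ c, |E a b| * |M b c| * |D c e| :=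
        Finset.sum_le_sum fun a _ => Finset.sum_le_sum fun e _ => hpt a e
    _ = ∑ a, ∑ b, ∑ e, ∑ c, |E a b| * |M b c| * |D c e| :=
        Finset.sum_congr rfl fun a _ => Finset.sum_comm
    _ = ∑ b, ∑ a, ∑ e, ∑ c, |E a b| * |M b c| * |D c e| := Finset.sum_comm
    _ = ∑ b, ∑ a, ∑ c, ∑ e, |E a b| * |M b c| * |D c e| :=
        Finset.sum_congr rfl fun b _ => Finset.sum_congr rfl fun a _ => Finset.sum_comm
    _ = ∑ b, ∑ c, ∑ a, ∑ e, |E a b| * |M b c| * |D c e| :=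
        Finset.sum_congr rfl fun b _ => Finset.sum_comm
    _ = ∑ b, ∑ c, (∑ a, |E a b|) * |M b c| * (∑ e, |D c e|) := by
        refine Finset.sum_congr rfl fun b _ => Finset.sum_congr rfl fun c _ => ?_
        rw [Finset.sum_mul, Finset.sum_mul]
        refine Finset.sum_congr rfl fun a _ => ?_
        rw [Finset.mul_sum]


omit [DecidableEq n] in
/-- ★ **The ℓ¹ norm of a triple product with SUMMED PROFILES (no `Fintype.card`).**  The COLUMN sums of `E` follow the profile `p`
(`Σ_a |E a b| ≤ ε·e^{−θ·p b}`), the middle factor decays off the diagonal at rate `θ` (`|M b c| ≤ μ·e^{−θ·dist b c}` — Combes–Thomas),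
the ROW sums of `D` follow the profile `q` (`Σ_e |D c e| ≤ δ·e^{−θ·q c}`), the profiles are `R` apart through `dist`
(`R ≤ p b + dist b c + q c`), and for some `0 ≤ θ₂ ≤ θ` the local sums are `Σ_b e^{−θ₂·p b} ≤ S_p`, `Σ_c e^{−θ₂·dist b c} ≤ S_dist` (every `b`).
Then `Σ_a Σ_e |(E·M·D) a e| ≤ ε·μ·δ·S_p·S_dist·e^{−(θ−θ₂)·R}` — the decay BETWEEN the two profiles is carried by the middle factor.
[cite: AizenmanWarzel2015, §10.3] [cite: HornJohnson2013, §5.6] -/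
theorem sum_sum_abs_mul3_le_of_summedProfiles (dist : n → n → ℕ) {E M D : Matrix n n ℝ}
    {ε μ δ θ θ₂ Sp Sdist : ℝ} (hε : 0 ≤ ε) (hμ : 0 ≤ μ) (hδ : 0 ≤ δ)
    (hθ₂ : 0 ≤ θ₂) (hθ₂θ : θ₂ ≤ θ) (hSdist0 : 0 ≤ Sdist)
    {p q : n → ℕ} (hE : ∀ b, ∑ a, |E a b| ≤ ε * Real.exp (-(θ * p b)))
    (hM : ∀ b c, |M b c| ≤ μ * Real.exp (-(θ * dist b c)))
    (hD : ∀ c, ∑ e, |D c e| ≤ δ * Real.exp (-(θ * q c)))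
    {R : ℕ} (hsep : ∀ b c, R ≤ p b + dist b c + q c)
    (hSp : ∑ b, Real.exp (-(θ₂ * p b)) ≤ Sp) (hSdi : ∀ b, ∑ c, Real.exp (-(θ₂ * dist b c)) ≤ Sdist) :
    ∑ a, ∑ e, |(E * M * D) a e| ≤ ε * μ * δ * Sp * Sdist * Real.exp (-((θ - θ₂) * R)) := by
  refine (sum_sum_abs_mul3_le E M D).trans ?_
  -- exponent bookkeeping: `θ(p + dist + q) ≥ (θ − θ₂)R + θ₂ p + θ₂ dist`
  have hexp : ∀ b c, Real.exp (-(θ * p b)) * Real.exp (-(θ * dist b c)) * Real.exp (-(θ * q c)) ≤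
      Real.exp (-((θ - θ₂) * R)) * (Real.exp (-(θ₂ * p b)) * Real.exp (-(θ₂ * dist b c))) := by
    intro b c
    rw [← Real.exp_add, ← Real.exp_add, ← Real.exp_add, ← Real.exp_add]
    refine Real.exp_le_exp.2 ?_
    have h : (R : ℝ) ≤ p b + dist b c + q c := by exact_mod_cast hsep b c
    have h1 : (0 : ℝ) ≤ q c := Nat.cast_nonneg _
    have h2 : (0 : ℝ) ≤ p b := Nat.cast_nonneg _
    have h3 : (0 : ℝ) ≤ dist b c := Nat.cast_nonneg _
    have h4 : 0 ≤ θ - θ₂ := sub_nonneg.2 hθ₂θ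
    nlinarith [mul_le_mul_of_nonneg_left h h4, mul_nonneg hθ₂ h1]
  have hterm : ∀ b c, (∑ a, |E a b|) * |M b c| * (∑ e, |D c e|) ≤
      ε * μ * δ * Real.exp (-((θ - θ₂) * R)) * (Real.exp (-(θ₂ * p b)) * Real.exp (-(θ₂ * dist b c))) := by
    intro b c
    have hEn : 0 ≤ ∑ a, |E a b| := Finset.sum_nonneg fun a _ => abs_nonneg _
    have hDn : 0 ≤ ∑ e, |D c e| := Finset.sum_nonneg fun e _ => abs_nonneg _
    have h0E : 0 ≤ ε * Real.exp (-(θ * p b)) := by positivity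
    have h0M : 0 ≤ μ * Real.exp (-(θ * dist b c)) := by positivity
    calc (∑ a, |E a b|) * |M b c| * (∑ e, |D c e|)
        ≤ (ε * Real.exp (-(θ * p b))) * (μ * Real.exp (-(θ * dist b c))) * (δ * Real.exp (-(θ * q c))) := by
          have h1 := hE b
          have h2 := hM b c
          have h3 := hD c
          gcongr
      _ = ε * μ * δ * (Real.exp (-(θ * p b)) * Real.exp (-(θ * dist b c)) * Real.exp (-(θ * q c))) := by ring
      _ ≤ ε * μ * δ * (Real.exp (-((θ - θ₂) * R)) * (Real.exp (-(θ₂ * p b)) * Real.exp (-(θ₂ * dist b c)))) :=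
          mul_le_mul_of_nonneg_left (hexp b c) (by positivity)
      _ = ε * μ * δ * Real.exp (-((θ - θ₂) * R)) * (Real.exp (-(θ₂ * p b)) * Real.exp (-(θ₂ * dist b c))) := by
          ring
  have hc : ∀ b, ∑ c, (∑ a, |E a b|) * |M b c| * (∑ e, |D c e|) ≤
      ε * μ * δ * Real.exp (-((θ - θ₂) * R)) * (Real.exp (-(θ₂ * p b)) * Sdist) := by
    intro b
    calc ∑ c, (∑ a, |E a b|) * |M b c| * (∑ e, |D c e|)
        ≤ ∑ c, ε * μ * δ * Real.exp (-((θ - θ₂) * R)) * (Real.exp (-(θ₂ * p b)) * Real.exp (-(θ₂ * dist b c))) :=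
          Finset.sum_le_sum fun c _ => hterm b c
      _ = ε * μ * δ * Real.exp (-((θ - θ₂) * R)) * (Real.exp (-(θ₂ * p b)) * ∑ c, Real.exp (-(θ₂ * dist b c))) := by
          rw [Finset.mul_sum, Finset.mul_sum]
      _ ≤ ε * μ * δ * Real.exp (-((θ - θ₂) * R)) * (Real.exp (-(θ₂ * p b)) * Sdist) := by
          have h := hSdi b
          have h0 : 0 ≤ ε * μ * δ * Real.exp (-((θ - θ₂) * R)) := by positivity
          exact mul_le_mul_of_nonneg_left (mul_le_mul_of_nonneg_left h (Real.exp_pos _).le) h0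
  calc ∑ b, ∑ c, (∑ a, |E a b|) * |M b c| * (∑ e, |D c e|)
      ≤ ∑ b, ε * μ * δ * Real.exp (-((θ - θ₂) * R)) * (Real.exp (-(θ₂ * p b)) * Sdist) :=
        Finset.sum_le_sum fun b _ => hc b
    _ = ε * μ * δ * Real.exp (-((θ - θ₂) * R)) * ((∑ b, Real.exp (-(θ₂ * p b))) * Sdist) := by
        rw [Finset.sum_mul, Finset.mul_sum]
    _ ≤ ε * μ * δ * Real.exp (-((θ - θ₂) * R)) * (Sp * Sdist) := by
        have h0 : 0 ≤ ε * μ * δ * Real.exp (-((θ - θ₂) * R)) := by positivity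
        exact mul_le_mul_of_nonneg_left (mul_le_mul_of_nonneg_right hSp hSdist0) h0
    _ = ε * μ * δ * Sp * Sdist * Real.exp (-((θ - θ₂) * R)) := by ring

/-! ## §3 The rectangle: `ΔΔ tr(K⁻¹H)` with Combes–Thomas inverses and locally summed variations -/

/-- ★★ **`ΔΔ tr(K⁻¹H)` OVER A RECTANGLE WITH LOCALLY SUMMED VARIATIONS (no `Fintype.card`, no path, no FTC).**
Four invertible real matrices `K i j` (`i` = the move at the first «bond», size `s ≥ 0`, localised along the profile `d`;
`j` = the move at the second bond, size `t ≥ 0`, profile `d′`) and four matrices `H i j`, over a finite index type with a symmetric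
`ℕ`-valued pseudo-distance `dist`.  ROWS: (A) Combes–Thomas profile of the four inverses `|K i j⁻¹ a b| ≤ α·e^{−θ·dist a b}`;
(sep) `R ≤ d a + dist a b + d′ b`; local sums `Σ_a e^{−θ₂·d a}, Σ_a e^{−θ₂·d′ a} ≤ S_loc`, `Σ_b e^{−θ₂·dist a b} ≤ S_dist` for some
`0 ≤ θ₂ ≤ θ`; (K) the five localised first-difference sums the expansion uses — COLUMN sums of `Δ¹K₀ = K₁₀ − K₀₀`, `Δ¹K₁ = K₁₁ − K₀₁`
(`≤ k₁·s·e^{−θ·d}`) and of `Δ²K₁ = K₁₁ − K₁₀` (`≤ k₂·t·e^{−θ·d′}`), ROW sums of `Δ¹K₀` (`≤ k₁·s·e^{−θ·d}`) and `Δ²K₀ = K₀₁ − K₀₀`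
(`≤ k₂·t·e^{−θ·d′}`) (for a symmetric `K`, e.g. a Hessian, row and column sums coincide); (KK) the ℓ¹ two-profile row
`Σ|ΔΔK| ≤ k₁₂·s·t·e^{−(θ−θ₂)R}` (supplied from a pointwise two-profile row by `sum_sum_abs_le_of_twoProfile_range`); (H) `Σ|H₀₀| ≤ η`,
ROW sums of `Δ¹H₀ = H₁₀ − H₀₀` (`≤ h₁·s·e^{−θ·d}`) and `Δ²H₀ = H₀₁ − H₀₀` (`≤ h₂·t·e^{−θ·d′}`), ℓ¹ row `Σ|ΔΔH| ≤ h₁₂·s·t·e^{−(θ−θ₂)R}`.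
THEN
`|tr(K₁₁⁻¹H₁₁) − tr(K₁₀⁻¹H₁₀) − tr(K₀₁⁻¹H₀₁) + tr(K₀₀⁻¹H₀₀)| ≤`
`(α·h₁₂ + α²·S_loc·S_dist·(k₁·h₂ + k₂·h₁) + α²·η·k₁₂ + 2·α³·η·S_loc·S_dist·k₁·k₂)·s·t·e^{−(θ−θ₂)·R}`.
PROOF: discrete Leibniz + the second-order resolvent expansion (`doubleDiff_inv_eq`) write `ΔΔ(K⁻¹H)` as SIX products; the two with an
ℓ¹ two-profile factor (`K₁₁⁻¹·ΔΔH`, `K₁₁⁻¹·ΔΔK·K₀₁⁻¹·H₀₀`) are bounded by `abs_trace_mul_le_of_entry_le_of_sum_le`; in the other four the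
decay between the two profiles is carried by ONE inverse sandwiched between a `d`-localised and a `d′`-localised difference
(`sum_sum_abs_mul3_le_of_summedProfiles`).  This is the localised, card-free edition of the normed-ring bilinear bound
`‖ΔΔ(K⁻¹H)‖ ≤ (a·h₁₂ + a²(k₁h₂ + k₂h₁) + (a²k₁₂ + 2a³k₁k₂)·h)·s·t` (same polynomial, `S`-decorated), and the sibling for the one-loop
TRACE of `abs_fourPt_log_det_le_of_summedProfiles` (the one-loop DETERMINANT).  HONEST SCOPE: finite-dimensional linear algebra; every
row is a hypothesis; which indexing makes `α, θ, S_loc, S_dist` and the letters uniform in the size of the system is the consumer's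
analysis ([Balaban1984PropagatorsII] (1.33) for lattice gauge theory), not this lemma's.
[cite: Balaban1985Variational, Thm 1 (10) p. 279] [cite: GlimmJaffe1987, §18.2] [cite: HornJohnson2013, §0.7.4] -/
theorem abs_fourPt_trace_inv_mul_le_of_summedProfiles (dist : n → n → ℕ) (hds : ∀ a b, dist a b = dist b a)
    {K₀₀ K₀₁ K₁₀ K₁₁ H₀₀ H₀₁ H₁₀ H₁₁ : Matrix n n ℝ}
    (h₀₀ : K₀₀.det ≠ 0) (h₀₁ : K₀₁.det ≠ 0) (h₁₀ : K₁₀.det ≠ 0) (h₁₁ : K₁₁.det ≠ 0)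
    {α η k₁ k₂ k₁₂ h₁ h₂ h₁₂ s t θ θ₂ Sloc Sdist : ℝ}
    (hα : 0 ≤ α) (hk₁ : 0 ≤ k₁) (hk₂ : 0 ≤ k₂) (hh₁ : 0 ≤ h₁) (hh₂ : 0 ≤ h₂) (hs : 0 ≤ s) (ht : 0 ≤ t)
    (hθ₂ : 0 ≤ θ₂) (hθ₂θ : θ₂ ≤ θ) (hSdist0 : 0 ≤ Sdist)
    (hA₀₀ : ∀ a b, |K₀₀⁻¹ a b| ≤ α * Real.exp (-(θ * dist a b)))
    (hA₀₁ : ∀ a b, |K₀₁⁻¹ a b| ≤ α * Real.exp (-(θ * dist a b)))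
    (hA₁₀ : ∀ a b, |K₁₀⁻¹ a b| ≤ α * Real.exp (-(θ * dist a b)))
    (hA₁₁ : ∀ a b, |K₁₁⁻¹ a b| ≤ α * Real.exp (-(θ * dist a b)))
    {d d' : n → ℕ} {R : ℕ} (hsep : ∀ a b, R ≤ d a + dist a b + d' b)
    (hSd : ∑ a, Real.exp (-(θ₂ * d a)) ≤ Sloc) (hSd' : ∑ a, Real.exp (-(θ₂ * d' a)) ≤ Sloc)
    (hSdi : ∀ a, ∑ b, Real.exp (-(θ₂ * dist a b)) ≤ Sdist)
    (hK1c0 : ∀ b, ∑ a, |(K₁₀ - K₀₀) a b| ≤ k₁ * s * Real.exp (-(θ * d b)))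
    (hK1c1 : ∀ b, ∑ a, |(K₁₁ - K₀₁) a b| ≤ k₁ * s * Real.exp (-(θ * d b)))
    (hK1r0 : ∀ a, ∑ b, |(K₁₀ - K₀₀) a b| ≤ k₁ * s * Real.exp (-(θ * d a)))
    (hK2c1 : ∀ b, ∑ a, |(K₁₁ - K₁₀) a b| ≤ k₂ * t * Real.exp (-(θ * d' b)))
    (hK2r0 : ∀ a, ∑ b, |(K₀₁ - K₀₀) a b| ≤ k₂ * t * Real.exp (-(θ * d' a)))
    (hK12 : ∑ a, ∑ b, |(K₁₁ - K₁₀ - K₀₁ + K₀₀) a b| ≤ k₁₂ * s * t * Real.exp (-((θ - θ₂) * R)))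
    (hH : ∑ a, ∑ b, |H₀₀ a b| ≤ η)
    (hH1r : ∀ a, ∑ b, |(H₁₀ - H₀₀) a b| ≤ h₁ * s * Real.exp (-(θ * d a)))
    (hH2r : ∀ a, ∑ b, |(H₀₁ - H₀₀) a b| ≤ h₂ * t * Real.exp (-(θ * d' a)))
    (hH12 : ∑ a, ∑ b, |(H₁₁ - H₁₀ - H₀₁ + H₀₀) a b| ≤ h₁₂ * s * t * Real.exp (-((θ - θ₂) * R))) :
    |(K₁₁⁻¹ * H₁₁).trace - (K₁₀⁻¹ * H₁₀).trace - (K₀₁⁻¹ * H₀₁).trace + (K₀₀⁻¹ * H₀₀).trace| ≤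
      (α * h₁₂ + α ^ 2 * Sloc * Sdist * (k₁ * h₂ + k₂ * h₁) + α ^ 2 * η * k₁₂ +
          2 * α ^ 3 * η * Sloc * Sdist * k₁ * k₂) * s * t * Real.exp (-((θ - θ₂) * R)) := by
  -- abbreviations and elementary consequences of the rows
  set Ex : ℝ := Real.exp (-((θ - θ₂) * R)) with hEx
  have hθ : 0 ≤ θ := hθ₂.trans hθ₂θ
  have hent : ∀ {A : Matrix n n ℝ}, (∀ a b, |A a b| ≤ α * Real.exp (-(θ * dist a b))) → ∀ a b, |A a b| ≤ α := by
    intro A hA a b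
    refine (hA a b).trans ?_
    have : Real.exp (-(θ * dist a b)) ≤ 1 := by
      rw [Real.exp_le_one_iff]
      have : (0 : ℝ) ≤ dist a b := Nat.cast_nonneg _
      nlinarith
    simpa using mul_le_mul_of_nonneg_left this hα
  have hη : 0 ≤ η := (Finset.sum_nonneg fun a _ => Finset.sum_nonneg fun b _ => abs_nonneg _).trans hH
  have hsep' : ∀ a b, R ≤ d' a + dist a b + d b := by
    intro a b; have := hsep b a; rw [hds] at this; omega
  -- the three-factor entry bound `|(K⁻¹·H₀₀·K₁₁⁻¹) b a| ≤ α·η·α`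
  have hB : ∀ {A : Matrix n n ℝ}, (∀ a b, |A a b| ≤ α * Real.exp (-(θ * dist a b))) →
      ∀ b a, |(A * H₀₀ * K₁₁⁻¹) b a| ≤ α * η * α := fun hA =>
    abs_mul3_apply_le_of_sum_le hα hα (hent hA) (hent hA₁₁) hH
  -- STEP 1: the algebraic expansion of `ΔΔ(K⁻¹H)` into six products
  have e1 : K₁₁⁻¹ - K₀₁⁻¹ = -(K₁₁⁻¹ * (K₁₁ - K₀₁) * K₀₁⁻¹) := inv_sub_inv_eq_neg_mul h₀₁ h₁₁
  have e4 : K₁₁⁻¹ - K₁₀⁻¹ = -(K₁₁⁻¹ * (K₁₁ - K₁₀) * K₁₀⁻¹) := inv_sub_inv_eq_neg_mul h₁₀ h₁₁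
  have expand : K₁₁⁻¹ * H₁₁ - K₁₀⁻¹ * H₁₀ - K₀₁⁻¹ * H₀₁ + K₀₀⁻¹ * H₀₀ =
      K₁₁⁻¹ * (H₁₁ - H₁₀ - H₀₁ + H₀₀)
        - K₁₁⁻¹ * ((K₁₁ - K₀₁) * K₀₁⁻¹ * (H₀₁ - H₀₀))
        - K₁₁⁻¹ * ((K₁₁ - K₁₀) * K₁₀⁻¹ * (H₁₀ - H₀₀))
        - K₁₁⁻¹ * (K₁₁ - K₁₀ - K₀₁ + K₀₀) * (K₀₁⁻¹ * H₀₀)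
        + K₁₁⁻¹ * ((K₁₀ - K₀₀) * K₀₁⁻¹ * (K₀₁ - K₀₀)) * (K₀₀⁻¹ * H₀₀)
        + K₁₁⁻¹ * ((K₁₁ - K₁₀) * K₁₀⁻¹ * (K₁₀ - K₀₀)) * (K₀₀⁻¹ * H₀₀) := by
    rw [doubleDiff_mul_eq_matrix, doubleDiff_inv_eq h₀₀ h₀₁ h₁₀ h₁₁, e1, e4]
    noncomm_ring
  -- STEP 2: traces of the six products
  have T1 : |(K₁₁⁻¹ * (H₁₁ - H₁₀ - H₀₁ + H₀₀)).trace| ≤ α * (h₁₂ * s * t * Ex) :=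
    abs_trace_mul_le_of_entry_le_of_sum_le hα (hent hA₁₁) hH12
  have L2 : ∑ a, ∑ e, |((K₁₁ - K₀₁) * K₀₁⁻¹ * (H₀₁ - H₀₀)) a e| ≤ (k₁ * s) * α * (h₂ * t) * Sloc * Sdist * Ex :=
    sum_sum_abs_mul3_le_of_summedProfiles dist (by positivity) hα (by positivity) hθ₂ hθ₂θ hSdist0
      hK1c1 hA₀₁ hH2r hsep hSd hSdi
  have T2 : |(K₁₁⁻¹ * ((K₁₁ - K₀₁) * K₀₁⁻¹ * (H₀₁ - H₀₀))).trace| ≤ α * ((k₁ * s) * α * (h₂ * t) * Sloc * Sdist * Ex) :=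
    abs_trace_mul_le_of_entry_le_of_sum_le hα (hent hA₁₁) L2
  have L3 : ∑ a, ∑ e, |((K₁₁ - K₁₀) * K₁₀⁻¹ * (H₁₀ - H₀₀)) a e| ≤ (k₂ * t) * α * (h₁ * s) * Sloc * Sdist * Ex :=
    sum_sum_abs_mul3_le_of_summedProfiles dist (by positivity) hα (by positivity) hθ₂ hθ₂θ hSdist0
      hK2c1 hA₁₀ hH1r hsep' hSd' hSdi
  have T3 : |(K₁₁⁻¹ * ((K₁₁ - K₁₀) * K₁₀⁻¹ * (H₁₀ - H₀₀))).trace| ≤ α * ((k₂ * t) * α * (h₁ * s) * Sloc * Sdist * Ex) :=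
    abs_trace_mul_le_of_entry_le_of_sum_le hα (hent hA₁₁) L3
  have T4a : |(K₁₁⁻¹ * (K₁₁ - K₁₀ - K₀₁ + K₀₀) * (K₀₁⁻¹ * H₀₀)).trace| ≤ (α * η * α) * (k₁₂ * s * t * Ex) := by
    rw [Matrix.trace_mul_cycle]
    exact abs_trace_mul_le_of_entry_le_of_sum_le (by positivity) (hB hA₀₁) hK12
  have L4b : ∑ a, ∑ e, |((K₁₀ - K₀₀) * K₀₁⁻¹ * (K₀₁ - K₀₀)) a e| ≤ (k₁ * s) * α * (k₂ * t) * Sloc * Sdist * Ex :=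
    sum_sum_abs_mul3_le_of_summedProfiles dist (by positivity) hα (by positivity) hθ₂ hθ₂θ hSdist0
      hK1c0 hA₀₁ hK2r0 hsep hSd hSdi
  have T4b : |(K₁₁⁻¹ * ((K₁₀ - K₀₀) * K₀₁⁻¹ * (K₀₁ - K₀₀)) * (K₀₀⁻¹ * H₀₀)).trace| ≤
      (α * η * α) * ((k₁ * s) * α * (k₂ * t) * Sloc * Sdist * Ex) := by
    rw [Matrix.trace_mul_cycle]
    exact abs_trace_mul_le_of_entry_le_of_sum_le (by positivity) (hB hA₀₀) L4b
  have L4c : ∑ a, ∑ e, |((K₁₁ - K₁₀) * K₁₀⁻¹ * (K₁₀ - K₀₀)) a e| ≤ (k₂ * t) * α * (k₁ * s) * Sloc * Sdist * Ex :=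
    sum_sum_abs_mul3_le_of_summedProfiles dist (by positivity) hα (by positivity) hθ₂ hθ₂θ hSdist0
      hK2c1 hA₁₀ hK1r0 hsep' hSd' hSdi
  have T4c : |(K₁₁⁻¹ * ((K₁₁ - K₁₀) * K₁₀⁻¹ * (K₁₀ - K₀₀)) * (K₀₀⁻¹ * H₀₀)).trace| ≤
      (α * η * α) * ((k₂ * t) * α * (k₁ * s) * Sloc * Sdist * Ex) := by
    rw [Matrix.trace_mul_cycle]
    exact abs_trace_mul_le_of_entry_le_of_sum_le (by positivity) (hB hA₀₀) L4c
  -- STEP 3: assemble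
  have htr : (K₁₁⁻¹ * H₁₁).trace - (K₁₀⁻¹ * H₁₀).trace - (K₀₁⁻¹ * H₀₁).trace + (K₀₀⁻¹ * H₀₀).trace =
      (K₁₁⁻¹ * (H₁₁ - H₁₀ - H₀₁ + H₀₀)).trace
        - (K₁₁⁻¹ * ((K₁₁ - K₀₁) * K₀₁⁻¹ * (H₀₁ - H₀₀))).trace
        - (K₁₁⁻¹ * ((K₁₁ - K₁₀) * K₁₀⁻¹ * (H₁₀ - H₀₀))).trace
        - (K₁₁⁻¹ * (K₁₁ - K₁₀ - K₀₁ + K₀₀) * (K₀₁⁻¹ * H₀₀)).trace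
        + (K₁₁⁻¹ * ((K₁₀ - K₀₀) * K₀₁⁻¹ * (K₀₁ - K₀₀)) * (K₀₀⁻¹ * H₀₀)).trace
        + (K₁₁⁻¹ * ((K₁₁ - K₁₀) * K₁₀⁻¹ * (K₁₀ - K₀₀)) * (K₀₀⁻¹ * H₀₀)).trace := by
    rw [← Matrix.trace_sub, ← Matrix.trace_sub, ← Matrix.trace_add, expand]
    simp only [Matrix.trace_sub, Matrix.trace_add]
  rw [htr]
  have n1 := abs_add_le
    ((K₁₁⁻¹ * (H₁₁ - H₁₀ - H₀₁ + H₀₀)).trace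
        - (K₁₁⁻¹ * ((K₁₁ - K₀₁) * K₀₁⁻¹ * (H₀₁ - H₀₀))).trace
        - (K₁₁⁻¹ * ((K₁₁ - K₁₀) * K₁₀⁻¹ * (H₁₀ - H₀₀))).trace
        - (K₁₁⁻¹ * (K₁₁ - K₁₀ - K₀₁ + K₀₀) * (K₀₁⁻¹ * H₀₀)).trace
        + (K₁₁⁻¹ * ((K₁₀ - K₀₀) * K₀₁⁻¹ * (K₀₁ - K₀₀)) * (K₀₀⁻¹ * H₀₀)).trace)
    ((K₁₁⁻¹ * ((K₁₁ - K₁₀) * K₁₀⁻¹ * (K₁₀ - K₀₀)) * (K₀₀⁻¹ * H₀₀)).trace)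
  have n2 := abs_add_le
    ((K₁₁⁻¹ * (H₁₁ - H₁₀ - H₀₁ + H₀₀)).trace
        - (K₁₁⁻¹ * ((K₁₁ - K₀₁) * K₀₁⁻¹ * (H₀₁ - H₀₀))).trace
        - (K₁₁⁻¹ * ((K₁₁ - K₁₀) * K₁₀⁻¹ * (H₁₀ - H₀₀))).trace
        - (K₁₁⁻¹ * (K₁₁ - K₁₀ - K₀₁ + K₀₀) * (K₀₁⁻¹ * H₀₀)).trace)
    ((K₁₁⁻¹ * ((K₁₀ - K₀₀) * K₀₁⁻¹ * (K₀₁ - K₀₀)) * (K₀₀⁻¹ * H₀₀)).trace)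
  have n3 := abs_sub
    ((K₁₁⁻¹ * (H₁₁ - H₁₀ - H₀₁ + H₀₀)).trace
        - (K₁₁⁻¹ * ((K₁₁ - K₀₁) * K₀₁⁻¹ * (H₀₁ - H₀₀))).trace
        - (K₁₁⁻¹ * ((K₁₁ - K₁₀) * K₁₀⁻¹ * (H₁₀ - H₀₀))).trace)
    ((K₁₁⁻¹ * (K₁₁ - K₁₀ - K₀₁ + K₀₀) * (K₀₁⁻¹ * H₀₀)).trace)
  have n4 := abs_sub
    ((K₁₁⁻¹ * (H₁₁ - H₁₀ - H₀₁ + H₀₀)).trace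
        - (K₁₁⁻¹ * ((K₁₁ - K₀₁) * K₀₁⁻¹ * (H₀₁ - H₀₀))).trace)
    ((K₁₁⁻¹ * ((K₁₁ - K₁₀) * K₁₀⁻¹ * (H₁₀ - H₀₀))).trace)
  have n5 := abs_sub ((K₁₁⁻¹ * (H₁₁ - H₁₀ - H₀₁ + H₀₀)).trace)
    ((K₁₁⁻¹ * ((K₁₁ - K₀₁) * K₀₁⁻¹ * (H₀₁ - H₀₀))).trace)
  have e : (α * h₁₂ + α ^ 2 * Sloc * Sdist * (k₁ * h₂ + k₂ * h₁) + α ^ 2 * η * k₁₂ +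
          2 * α ^ 3 * η * Sloc * Sdist * k₁ * k₂) * s * t * Ex =
      α * (h₁₂ * s * t * Ex) + α * ((k₁ * s) * α * (h₂ * t) * Sloc * Sdist * Ex)
        + α * ((k₂ * t) * α * (h₁ * s) * Sloc * Sdist * Ex) + (α * η * α) * (k₁₂ * s * t * Ex)
        + (α * η * α) * ((k₁ * s) * α * (k₂ * t) * Sloc * Sdist * Ex)
        + (α * η * α) * ((k₂ * t) * α * (k₁ * s) * Sloc * Sdist * Ex) := by ring
  rw [e]
  linarith [n1, n2, n3, n4, n5, T1, T2, T3, T4a, T4b, T4c]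

end Literature.Analysis.Matrix

end
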